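import Mathlib.Analysis.Distribution.AEEqOfIntegralContDiff
import Mathlib.MeasureTheory.Function.LocallyIntegrable
import Mathlib.MeasureTheory.Function.LpSeminorm.CompareExp
import Mathlib.Analysis.InnerProductSpace.PiL2
import HarnessLib.Audit
import HarnessLib

/-!
# L3TimeExponentPincer — from `L³_loc` convergence on `(0,∞) × ℝ³` to distributional convergence of time-cut fields on `ℝ × ℝ³`

Support kernel for the crux `L3CascadeJaw` (item stmt-NavierStokesRegularity-19499) of route
`L3TimeExponentPincer`; plumbing for CASE B of the compactness step (J) of planner nsreg-p2's
ROUND-12 §2b (see the blueprint attached to the item).  The compactness situation of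
Rusin–Šverák's Prop. 2.2 (`RusinSverak2011.CompactnessSituation`, field `tendsto_lintegral`)
delivers `∫∫_K ‖u^k - u‖³ → 0` for every compact `K ⊆ O = (0,∞) × ℝ³`; the symmetry-passage
lemmas (`…Theorems.L3TimeExponentPincerEquivariantLimit`) consume distributional convergence on
the WHOLE space with locally uniform `L¹` bounds.  The bridge is the time cut at height `δ > 0`:
`F_δ^k = 1_{t > δ} u^k` (extended by `0`), for which

* `locallyIntegrable_timeCut` — `F_δ` is locally integrable on `ℝ × ℝ³` when `u` is locally
  integrable on `(0,∞) × ℝ³`;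
* `tendsto_integral_smul_timeCut` — `∫ g • F_δ^k → ∫ g • F_δ` for every continuous compactly
  supported `g` (Hölder on `K = tsupport g ∩ {t ≥ δ}`);
* `exists_setIntegral_norm_timeCut_le` — locally uniform `L¹` bounds `∫_{B̄_R} ‖F_δ^k‖ ≤ C`
  for all `k` (eventually from the convergence, and the finitely many early terms are finite).

Pure measure theory (Mathlib-only); `ℝ × ℝ³` carries the product (sup-norm) metric and the
product Lebesgue measure.  WHAT THIS IS NOT: not NS regularity or blow-up; the crux `L3CascadeJaw`
is untouched; no crux claim.
-/

noncomputable section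

open MeasureTheory Set Function Filter Topology Metric
open scoped ENNReal NNReal

namespace Summit.NavierStokesRegularity.NavierStokesRegularity.Theorems.L3TimeExponentPincerTimeCutConvergence

variable {F : Type*} [NormedAddCommGroup F] [NormedSpace ℝ F] [CompleteSpace F]

/-! ### Geometry of the cut -/

/-- The closed half-space `{t ≥ δ}` meets every compact set in a compact set contained in
`{t > 0}` when `δ > 0`. -/
theorem isCompact_inter_timeHalfspace {K : Set (ℝ × EuclideanSpace ℝ (Fin 3))} (hK : IsCompact K)
    (δ : ℝ) : IsCompact (K ∩ (Ici δ ×ˢ (univ : Set (EuclideanSpace ℝ (Fin 3))))) :=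
  hK.inter_right (isClosed_Ici.prod isClosed_univ)

/-- For `δ > 0` the set `K ∩ {t ≥ δ}` lies in the open half-space `{t > 0}`. -/
theorem inter_timeHalfspace_subset_pos {K : Set (ℝ × EuclideanSpace ℝ (Fin 3))} {δ : ℝ} (hδ : 0 < δ) :
    K ∩ (Ici δ ×ˢ (univ : Set (EuclideanSpace ℝ (Fin 3)))) ⊆ {z | 0 < z.1} := by
  rintro z ⟨-, hz, -⟩
  exact lt_of_lt_of_le hδ hz

/-! ### Local integrability of the cut field -/

omit [NormedSpace ℝ F] [CompleteSpace F] in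
/-- **The time-cut field is locally integrable on the whole space.** If `u` is locally integrable
on `{t > 0}` and `δ > 0`, then `1_{t > δ} u` (zero elsewhere) is locally integrable on `ℝ × ℝ³`. -/
theorem locallyIntegrable_timeCut {u : ℝ × EuclideanSpace ℝ (Fin 3) → F}
    (hu : LocallyIntegrableOn u {z | 0 < z.1} volume) {δ : ℝ} (hδ : 0 < δ) :
    LocallyIntegrable ((Ioi δ ×ˢ (univ : Set (EuclideanSpace ℝ (Fin 3)))).indicator u) volume := by
  rw [locallyIntegrable_iff]
  intro K hK
  rw [integrableOn_indicator_iff (measurableSet_Ioi.prod MeasurableSet.univ)]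
  have hsub : (Ioi δ ×ˢ (univ : Set (EuclideanSpace ℝ (Fin 3)))) ∩ K ⊆
      K ∩ (Ici δ ×ˢ (univ : Set (EuclideanSpace ℝ (Fin 3)))) := by
    rintro z ⟨⟨hz1, -⟩, hzK⟩
    exact ⟨hzK, mem_Ici.2 (le_of_lt hz1), mem_univ _⟩
  exact (hu.integrableOn_compact_subset (inter_timeHalfspace_subset_pos hδ)
    (isCompact_inter_timeHalfspace hK δ)).mono_set hsub

/-! ### Hölder on a compact set: `L¹ ≤ |K|^{2/3} L³` -/

omit [NormedSpace ℝ F] [CompleteSpace F] in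
/-- `∫_K ‖h‖ ≤ (∫_K ‖h‖³)^{1/3} · |K|^{2/3}` in `ℝ≥0∞` (Hölder on the restricted measure). -/
theorem lintegral_enorm_le_cube_root_mul {X : Type*} [MeasurableSpace X] {μ : Measure X}
    {h : X → F} {K : Set X} (hh : AEStronglyMeasurable h (μ.restrict K)) :
    ∫⁻ z in K, ‖h z‖ₑ ∂μ ≤ (∫⁻ z in K, ‖h z‖ₑ ^ (3 : ℕ) ∂μ) ^ (1 / 3 : ℝ) * μ K ^ (2 / 3 : ℝ) := by
  have h13 : (1 : ℝ≥0∞) ≤ 3 := by norm_num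
  have key := eLpNorm_le_eLpNorm_mul_rpow_measure_univ h13 hh
  rw [eLpNorm_one_eq_lintegral_enorm, Measure.restrict_apply_univ] at key
  have e3 : eLpNorm h 3 (μ.restrict K) = (∫⁻ z in K, ‖h z‖ₑ ^ (3 : ℕ) ∂μ) ^ (1 / 3 : ℝ) := by
    rw [eLpNorm_eq_lintegral_rpow_enorm_toReal (by norm_num) (by norm_num)]
    simp only [ENNReal.toReal_ofNat, one_div]
    congr 1
    refine lintegral_congr fun z => ?_
    rw [show (3 : ℝ) = ((3 : ℕ) : ℝ) by norm_num, ENNReal.rpow_natCast]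
  rw [e3] at key
  have hexp : (1 : ℝ) / (1 : ℝ≥0∞).toReal - 1 / (3 : ℝ≥0∞).toReal = 2 / 3 := by
    rw [ENNReal.toReal_one, ENNReal.toReal_ofNat]; norm_num
  rw [hexp] at key
  exact key

omit [NormedSpace ℝ F] [CompleteSpace F] in
/-- Cube roots of a null sequence in `ℝ≥0∞` form a null sequence. -/
theorem tendsto_rpow_third_of_tendsto_zero {s : ℕ → ℝ≥0∞} (h : Tendsto s atTop (𝓝 0)) :
    Tendsto (fun k => s k ^ (1 / 3 : ℝ)) atTop (𝓝 0) := by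
  have := ((ENNReal.continuous_rpow_const (y := (1 / 3 : ℝ))).tendsto 0).comp h
  simpa [Function.comp_def, ENNReal.zero_rpow_of_pos (by norm_num : (0 : ℝ) < 1 / 3)] using this

/-! ### Distributional convergence of the cut fields -/

omit [CompleteSpace F] in
/-- **`L³_loc` convergence on `{t > 0}` gives distributional convergence of the time-cut
fields.**  If `∫∫_K ‖u^k - u‖³ → 0` for every compact `K ⊆ {t > 0}`, all fields locally integrable
on `{t > 0}`, and `δ > 0`, then for every continuous compactly supported `g : ℝ × ℝ³ → ℝ`,
`∫ g • (1_{t>δ} u^k) → ∫ g • (1_{t>δ} u)`. -/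
theorem tendsto_integral_smul_timeCut
    {useq : ℕ → ℝ × EuclideanSpace ℝ (Fin 3) → F} {u : ℝ × EuclideanSpace ℝ (Fin 3) → F}
    (hL3 : ∀ K ⊆ {z : ℝ × EuclideanSpace ℝ (Fin 3) | 0 < z.1}, IsCompact K →
      Tendsto (fun k => ∫⁻ z in K, ‖useq k z - u z‖ₑ ^ (3 : ℕ)) atTop (𝓝 0))
    (huk : ∀ k, LocallyIntegrableOn (useq k) {z | 0 < z.1} volume)
    (hu : LocallyIntegrableOn u {z | 0 < z.1} volume) {δ : ℝ} (hδ : 0 < δ)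
    {g : ℝ × EuclideanSpace ℝ (Fin 3) → ℝ} (hg : Continuous g) (hgs : HasCompactSupport g) :
    Tendsto (fun k => ∫ z, g z • (Ioi δ ×ˢ (univ : Set (EuclideanSpace ℝ (Fin 3)))).indicator (useq k) z)
      atTop (𝓝 (∫ z, g z • (Ioi δ ×ˢ (univ : Set (EuclideanSpace ℝ (Fin 3)))).indicator u z)) := by
  set S : Set (ℝ × EuclideanSpace ℝ (Fin 3)) := Ioi δ ×ˢ univ with hS
  have hSm : MeasurableSet S := measurableSet_Ioi.prod MeasurableSet.univ
  set K : Set (ℝ × EuclideanSpace ℝ (Fin 3)) := tsupport g ∩ (Ici δ ×ˢ univ) with hKdef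
  have hK : IsCompact K := isCompact_inter_timeHalfspace hgs δ
  have hKO : K ⊆ {z | 0 < z.1} := inter_timeHalfspace_subset_pos hδ
  have hKm : MeasurableSet K := hK.measurableSet
  have hμK : volume K < ⊤ := hK.measure_lt_top
  -- sup bound of `g`
  obtain ⟨Cg, hCg⟩ := hg.bounded_above_of_compact_support hgs
  have hCg0 : 0 ≤ Cg := le_trans (norm_nonneg _) (hCg 0)
  -- integrability
  have hFk : ∀ k, LocallyIntegrable (S.indicator (useq k)) volume := fun k =>
    locallyIntegrable_timeCut (huk k) hδ
  have hF : LocallyIntegrable (S.indicator u) volume := locallyIntegrable_timeCut hu hδ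
  have hIk : ∀ k, Integrable (fun z => g z • S.indicator (useq k) z) := fun k =>
    (hFk k).integrable_smul_left_of_hasCompactSupport hg hgs
  have hI : Integrable (fun z => g z • S.indicator u z) :=
    hF.integrable_smul_left_of_hasCompactSupport hg hgs
  have hdk : ∀ k, IntegrableOn (fun z => useq k z - u z) K volume := fun k =>
    ((huk k).integrableOn_compact_subset hKO hK).sub (hu.integrableOn_compact_subset hKO hK)
  -- pointwise domination of the difference integrand
  have hpt : ∀ k z, ‖g z • S.indicator (useq k) z - g z • S.indicator u z‖ ≤
      K.indicator (fun z => Cg * ‖useq k z - u z‖) z := by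
    intro k z
    by_cases hzK : z ∈ K
    · rw [indicator_of_mem hzK, ← smul_sub, norm_smul]
      refine mul_le_mul (by simpa using hCg z) ?_ (norm_nonneg _) hCg0
      by_cases hzS : z ∈ S
      · rw [indicator_of_mem hzS, indicator_of_mem hzS]
      · rw [indicator_of_notMem hzS, indicator_of_notMem hzS, sub_zero, norm_zero]
        exact norm_nonneg _
    · rw [indicator_of_notMem hzK]
      -- off `K`, either `g z = 0` or `z ∉ S`
      by_cases hzg : z ∈ tsupport g
      · have hzS : z ∉ S := by
          intro hzS
          exact hzK ⟨hzg, mem_Ici.2 (le_of_lt hzS.1), mem_univ _⟩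
        rw [indicator_of_notMem hzS, indicator_of_notMem hzS, smul_zero, sub_zero, norm_zero]
      · rw [image_eq_zero_of_notMem_tsupport hzg, zero_smul, zero_smul, sub_zero, norm_zero]
  -- the dominating sequence tends to `0`
  have hmeas : ∀ k, AEStronglyMeasurable (fun z => useq k z - u z) (volume.restrict K) := fun k =>
    (hdk k).aestronglyMeasurable
  have hT : Tendsto (fun k => ∫⁻ z in K, ‖useq k z - u z‖ₑ) atTop (𝓝 0) := by
    have h3 := hL3 K hKO hK
    have hroot : Tendsto (fun k => (∫⁻ z in K, ‖useq k z - u z‖ₑ ^ (3 : ℕ)) ^ (1 / 3 : ℝ) *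
        volume K ^ (2 / 3 : ℝ)) atTop (𝓝 0) := by
      have h1 : Tendsto (fun k => (∫⁻ z in K, ‖useq k z - u z‖ₑ ^ (3 : ℕ)) ^ (1 / 3 : ℝ)) atTop
          (𝓝 0) := tendsto_rpow_third_of_tendsto_zero h3
      have h2 := ENNReal.Tendsto.mul_const h1 (Or.inr (ENNReal.rpow_ne_top_of_nonneg
        (by norm_num : (0 : ℝ) ≤ 2 / 3) hμK.ne))
      simpa using h2
    exact tendsto_of_tendsto_of_tendsto_of_le_of_le tendsto_const_nhds hroot
      (fun k => zero_le) (fun k => lintegral_enorm_le_cube_root_mul (hmeas k))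
  have hTtop : ∀ k, ∫⁻ z in K, ‖useq k z - u z‖ₑ < ⊤ := fun k => (hdk k).2
  have hTreal : Tendsto (fun k => (∫⁻ z in K, ‖useq k z - u z‖ₑ).toReal) atTop (𝓝 0) := by
    have := (ENNReal.tendsto_toReal ENNReal.zero_ne_top).comp hT
    simpa [Function.comp_def] using this
  -- conclude by the squeeze
  rw [Metric.tendsto_atTop]
  intro ε hε
  obtain ⟨N, hN⟩ := Metric.tendsto_atTop.1 hTreal (ε / (Cg + 1)) (by positivity)
  refine ⟨N, fun k hk => ?_⟩
  have hNk := hN k hk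
  rw [Real.dist_eq, sub_zero, abs_of_nonneg ENNReal.toReal_nonneg] at hNk
  rw [dist_eq_norm, ← integral_sub (hIk k) hI]
  have hdom : Integrable (K.indicator (fun z => Cg * ‖useq k z - u z‖)) volume := by
    rw [integrable_indicator_iff hKm]
    exact (hdk k).norm.const_mul Cg
  calc ‖∫ z, (g z • S.indicator (useq k) z - g z • S.indicator u z)‖
      ≤ ∫ z, K.indicator (fun z => Cg * ‖useq k z - u z‖) z :=
        norm_integral_le_of_norm_le hdom (Eventually.of_forall (hpt k))
    _ = Cg * ∫ z in K, ‖useq k z - u z‖ := by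
        rw [integral_indicator hKm, integral_const_mul]
    _ = Cg * (∫⁻ z in K, ‖useq k z - u z‖ₑ).toReal := by
        rw [integral_norm_eq_lintegral_enorm (hmeas k)]
    _ ≤ Cg * (ε / (Cg + 1)) := by gcongr
    _ < ε := by
        rw [mul_div_assoc']
        rw [div_lt_iff₀ (by positivity)]
        nlinarith

/-! ### Locally uniform `L¹` bounds of the cut fields -/

omit [NormedSpace ℝ F] [CompleteSpace F] in
/-- **Locally uniform `L¹` bounds.**  Under the same hypotheses, for every radius `R` there is `C`
with `∫_{B̄(0,R)} ‖1_{t>δ} u^k‖ ≤ C` for ALL `k` (the closed ball of the sup-norm product metric is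
`[-R,R] × B̄_R`; eventually the bound comes from the `L³(K)` convergence, the finitely many early
terms are finite by local integrability). -/
theorem exists_setIntegral_norm_timeCut_le
    {useq : ℕ → ℝ × EuclideanSpace ℝ (Fin 3) → F} {u : ℝ × EuclideanSpace ℝ (Fin 3) → F}
    (hL3 : ∀ K ⊆ {z : ℝ × EuclideanSpace ℝ (Fin 3) | 0 < z.1}, IsCompact K →
      Tendsto (fun k => ∫⁻ z in K, ‖useq k z - u z‖ₑ ^ (3 : ℕ)) atTop (𝓝 0))
    (huk : ∀ k, LocallyIntegrableOn (useq k) {z | 0 < z.1} volume)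
    (hu : LocallyIntegrableOn u {z | 0 < z.1} volume) {δ : ℝ} (hδ : 0 < δ) (R : ℝ) :
    ∃ C : ℝ, ∀ k, ∫ z in closedBall (0 : ℝ × EuclideanSpace ℝ (Fin 3)) R,
      ‖(Ioi δ ×ˢ (univ : Set (EuclideanSpace ℝ (Fin 3)))).indicator (useq k) z‖ ≤ C := by
  set S : Set (ℝ × EuclideanSpace ℝ (Fin 3)) := Ioi δ ×ˢ univ with hS
  have hSm : MeasurableSet S := measurableSet_Ioi.prod MeasurableSet.univ
  set K : Set (ℝ × EuclideanSpace ℝ (Fin 3)) :=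
    closedBall (0 : ℝ × EuclideanSpace ℝ (Fin 3)) R ∩ (Ici δ ×ˢ univ) with hKdef
  have hK : IsCompact K := isCompact_inter_timeHalfspace (isCompact_closedBall _ _) δ
  have hKO : K ⊆ {z | 0 < z.1} := inter_timeHalfspace_subset_pos hδ
  have hKm : MeasurableSet K := hK.measurableSet
  have hdk : ∀ k, IntegrableOn (fun z => useq k z - u z) K volume := fun k =>
    ((huk k).integrableOn_compact_subset hKO hK).sub (hu.integrableOn_compact_subset hKO hK)
  have huK : IntegrableOn u K volume := hu.integrableOn_compact_subset hKO hK
  have hukK : ∀ k, IntegrableOn (useq k) K volume := fun k => (huk k).integrableOn_compact_subset hKO hK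
  -- the `L¹(B̄_R)` norm of the cut field is the `L¹(K)` norm of `u^k`
  have hred : ∀ k, ∫ z in closedBall (0 : ℝ × EuclideanSpace ℝ (Fin 3)) R, ‖S.indicator (useq k) z‖
      = ∫ z in K, ‖useq k z‖ := by
    intro k
    have h1 : (fun z => ‖S.indicator (useq k) z‖) = S.indicator (fun z => ‖useq k z‖) := by
      funext z
      by_cases hz : z ∈ S
      · rw [indicator_of_mem hz, indicator_of_mem hz]
      · rw [indicator_of_notMem hz, indicator_of_notMem hz, norm_zero]
    rw [h1, integral_indicator hSm, Measure.restrict_restrict hSm]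
    -- `S ∩ B̄_R` and `K = B̄_R ∩ {t ≥ δ}` differ by the null set `{t = δ} ∩ B̄_R`? No: `S ∩ B̄_R ⊆ K`,
    -- and on `K \ (S ∩ B̄_R) ⊆ {t = δ}` (a null set) the integrands may differ; use `ae` equality of sets.
    have hsub : S ∩ closedBall (0 : ℝ × EuclideanSpace ℝ (Fin 3)) R ⊆ K := by
      rintro z ⟨⟨hz1, -⟩, hzB⟩
      exact ⟨hzB, mem_Ici.2 (le_of_lt hz1), mem_univ _⟩
    have hdiff : K \ (S ∩ closedBall (0 : ℝ × EuclideanSpace ℝ (Fin 3)) R) ⊆ {δ} ×ˢ univ := by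
      rintro z ⟨⟨hzB, hz1, -⟩, hz⟩
      refine ⟨?_, mem_univ _⟩
      rcases eq_or_lt_of_le (mem_Ici.1 hz1) with h | h
      · exact h.symm
      · exact absurd ⟨⟨h, mem_univ _⟩, hzB⟩ hz
    have hnull : volume (({δ} : Set ℝ) ×ˢ (univ : Set (EuclideanSpace ℝ (Fin 3)))) = 0 := by
      rw [Measure.volume_eq_prod, Measure.prod_prod, Real.volume_singleton, zero_mul]
    have hae : (S ∩ closedBall (0 : ℝ × EuclideanSpace ℝ (Fin 3)) R : Set _) =ᵐ[volume] K := by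
      refine (ae_eq_set).2 ⟨?_, ?_⟩
      · exact measure_mono_null (fun z hz => (hz.2 (hsub hz.1)).elim) measure_empty
      · exact measure_mono_null hdiff hnull
    rw [Measure.restrict_congr_set hae]
  -- eventually: `∫_K ‖u^k‖ ≤ ∫_K ‖u^k - u‖ + ∫_K ‖u‖ ≤ 1 + ∫_K ‖u‖`
  have hT : Tendsto (fun k => ∫⁻ z in K, ‖useq k z - u z‖ₑ) atTop (𝓝 0) := by
    have h3 := hL3 K hKO hK
    have hμK : volume K < ⊤ := hK.measure_lt_top
    have h1 : Tendsto (fun k => (∫⁻ z in K, ‖useq k z - u z‖ₑ ^ (3 : ℕ)) ^ (1 / 3 : ℝ)) atTop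
        (𝓝 0) := tendsto_rpow_third_of_tendsto_zero h3
    have h2 := ENNReal.Tendsto.mul_const h1 (Or.inr (ENNReal.rpow_ne_top_of_nonneg
      (by norm_num : (0 : ℝ) ≤ 2 / 3) hμK.ne))
    simp only [zero_mul] at h2
    exact tendsto_of_tendsto_of_tendsto_of_le_of_le tendsto_const_nhds h2
      (fun k => zero_le) (fun k => lintegral_enorm_le_cube_root_mul (hdk k).aestronglyMeasurable)
  have hev : ∀ᶠ k in atTop, ∫ z in K, ‖useq k z‖ ≤ 1 + ∫ z in K, ‖u z‖ := by
    have h1 : ∀ᶠ k in atTop, ∫⁻ z in K, ‖useq k z - u z‖ₑ ≤ 1 :=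
      hT.eventually (ge_mem_nhds zero_lt_one)
    filter_upwards [h1] with k hk
    have hle : ∀ z, ‖useq k z‖ ≤ ‖useq k z - u z‖ + ‖u z‖ := fun z => by
      calc ‖useq k z‖ = ‖(useq k z - u z) + u z‖ := by rw [sub_add_cancel]
        _ ≤ _ := norm_add_le _ _
    calc ∫ z in K, ‖useq k z‖ ≤ ∫ z in K, (‖useq k z - u z‖ + ‖u z‖) :=
          integral_mono_of_nonneg (Eventually.of_forall fun _ => norm_nonneg _)
            ((hdk k).norm.add huK.norm) (Eventually.of_forall hle)
      _ = (∫ z in K, ‖useq k z - u z‖) + ∫ z in K, ‖u z‖ := integral_add (hdk k).norm huK.norm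
      _ ≤ 1 + ∫ z in K, ‖u z‖ := by
          gcongr
          rw [integral_norm_eq_lintegral_enorm (hdk k).aestronglyMeasurable]
          calc (∫⁻ z in K, ‖useq k z - u z‖ₑ).toReal ≤ (1 : ℝ≥0∞).toReal :=
                ENNReal.toReal_mono ENNReal.one_ne_top hk
            _ = 1 := ENNReal.toReal_one
  -- all `k`: add the finitely many early terms
  obtain ⟨N, hN⟩ := eventually_atTop.1 hev
  refine ⟨(1 + ∫ z in K, ‖u z‖) + ∑ j ∈ Finset.range N, ∫ z in K, ‖useq j z‖, fun k => ?_⟩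
  rw [hred k]
  have hnn : ∀ j, 0 ≤ ∫ z in K, ‖useq j z‖ := fun j => integral_nonneg fun _ => norm_nonneg _
  have hnn' : 0 ≤ 1 + ∫ z in K, ‖u z‖ := by positivity
  by_cases hk : N ≤ k
  · exact (hN k hk).trans (le_add_of_nonneg_right (Finset.sum_nonneg fun j _ => hnn j))
  · have hmem : k ∈ Finset.range N := Finset.mem_range.2 (not_le.1 hk)
    calc ∫ z in K, ‖useq k z‖ ≤ ∑ j ∈ Finset.range N, ∫ z in K, ‖useq j z‖ :=
          Finset.single_le_sum (fun j _ => hnn j) hmem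
      _ ≤ _ := le_add_of_nonneg_left hnn'

end Summit.NavierStokesRegularity.NavierStokesRegularity.Theorems.L3TimeExponentPincerTimeCutConvergence

end
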